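import Summits.HodgeConjecture.HodgeConjecture.Theorems.HCCMUnconditionalOfGenericFloorV7
import Summits.HodgeConjecture.CorCM.Hyp413.A3Liu413FaceTypes
import Summits.HodgeConjecture.HodgeConjecture.Theorems.H413CohFormsCarriersLemmas
import Summits.HodgeConjecture.HodgeConjecture.Theorems.H413MatsushimaHodgeClassMap
import Mathlib.RepresentationTheory.Intertwining
import HarnessLib

/-!
# FLOOR-0 P4 — `hocc` GLUE AS IMPORTABLE THEOREMS: `T3a → T3b → T3`, `T2 → T3 → hocc`, and (with ★ T2) `T3 → hocc`

Cell hodgecm-mathlib (D-0151), FLOOR 0, crux item H413 = stmt-HodgeConjecture-24833; programme P4.  Author A-p19 (g15).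
`--supports stmt-HodgeConjecture-24833 --as helper`.  THEOREMS ONLY (no `def`: the sub-line's `conjSandwich` is built inline).

WHY THIS FILE: the kernel-checked glue of the planner sub-line `Cruxes/H413/Lines/F0_P4AdmissibleOccursInH1.lean` (`stubT3_of`,
`occursInH1_of_classMap_of_thetaForms`, `admissible_occursInH1_holds_of`) lives in a `Lines/` module, which is NOT an importable farm module and may NOT be
imported by `Theorems/` files (gate lint) — so neither the PARENT line `Lines/P4AdmissibleOccursInH1.lean` (hole `stub_T3_thetaFormsAt`) nor the REGISTRY
skeleton `Lines/a3_liu413.lean` (hole `stub_admissible_occursInH1` = `HoccType`) can fold by name through it.  Here the same glue is restated with every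
letter INLINED VERBATIM (the bodies of `StubT3aHolThetaRealisationAt`, `StubT3bConjugatePartnerAt`, `StubT3ThetaFormsAt`, `StubT2MatsushimaHodgeAt`,
`HoccType` of the tree sub-line ed. 1.4 ∕ parent v2.2, token for token), so that the moment the T3 closers are ★ Theorems decls (S4′∕S6 → T3a, S5 → T3b):
* PARENT fold: `theorem stub_T3_thetaFormsAt : StubT3ThetaFormsAt := HoccGlue.thetaFormsAt_of_hol_of_partner <T3a closer> <T3b closer>`;
* REGISTRY fold (`a3_liu413.lean` v10.2): `theorem stub_admissible_occursInH1 : … := HoccGlue.hocc_of_thetaFormsAt (HoccGlue.thetaFormsAt_of_hol_of_partner …)`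
  (T2 is already ★: `MatsushimaHodge.t2_matsushimaHodgeAt`, p792532).
Proofs = the sub-line's, byte-near-identical (only `conjSandwich` ↦ an inline `LinearMap`).  HC_CM is proved only modulo the 7 printed citations until
rung 0 closes; this file proves nothing about them (pure modus ponens over the carriers).
[cite: Liu2021, proof of Prop. 4.13, l. 2145; App. D Lem. D.2 (2)] [cite: BorelWallach2000, VII 2.10]

## References
* [Liu2021] Y. Liu, *Fourier–Jacobi cycles and arithmetic relative trace formula*, Camb. J. Math. 9 (2021) — proof of Prop. 4.13 (l. 2145), App. D Lem. D.2 (2).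
* [BorelWallach2000] A. Borel, N. Wallach, 2nd ed., VII 2.10 (complex conjugation exchanges the Hodge types).
* Tree: sub-line `Cruxes/H413/Lines/F0_P4AdmissibleOccursInH1.lean` ed. 1.4 §0/§2/§3/§4 (letters and glue), ★ `Theorems/H413MatsushimaHodgeClassMap`
  (`MatsushimaHodge.t2_matsushimaHodgeAt`), ★ `Theorems/H413CohFormsCarriersLemmas` (`conjFun_conjFun`, `conjFun_rightRep`), ★ FloorV7, ★ `A3Liu413FaceTypes`.
-/

set_option autoImplicit false
set_option linter.dupNamespace false

noncomputable section

namespace Summit.HodgeConjecture.HodgeConjecture.Cruxes.H413.HoccGlue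

open scoped TensorProduct Matrix
open NumberField NumberField.InfinitePlace IsDedekindDomain
open HodgeCM.Model HodgeCM.Model.LiuIndex HodgeCM.Model.TowerCarrier
open Summit.HodgeConjecture.CorCM.Model
open Literature.AlgebraicGeometry.Motives (CMType AbelianVariety)
open Literature.AlgebraicGeometry.HodgeTheory Literature.NumberTheory.Automorphic.PicardCM
open Literature.AlgebraicGeometry.ShimuraVarieties Literature.AlgebraicGeometry.ShimuraVarieties.UnitaryCanonicalModel
open Literature.NumberTheory.ComplexMultiplication
open Literature.NumberTheory.Automorphic
open Literature.NumberTheory.Automorphic.Liu2021 Literature.NumberTheory.Automorphic.Liu2021.AppendixC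
open Literature.NumberTheory.Automorphic.Liu2021.Def411WeilCarriers (lineOf locF Rep)
open Summit.HodgeConjecture.CorCM.Transposition.OmegaTransport (realUnit)
open HodgeCM.Model.ArchSideTerm (e₁)
open Literature.NumberTheory.GelbartRogawski1991 Literature.NumberTheory.GelbartRogawski1991.UnitaryDualPair
open Literature.RepresentationTheory Literature.RepresentationTheory.Liu2021
open Summit.HodgeConjecture.CorCM
open Summit.HodgeConjecture.CorCM.Transposition
open Literature.NumberTheory.GelbartRogawski1991.OscillatorTripleDictionary (OccursInH1 IsIsoToOmega)
open Summit.HodgeConjecture.CorCM.Lines.A3Liu418 (Thm415AtFace EpsRigidAtFace)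
open Summit.HodgeConjecture.HodgeConjecture.Theses (HCCMUnconditional.HDel)
open MulAction
open Literature.Geometry.ComplexHyperbolic.BallModel (U21 x₀)
open Literature.NumberTheory.GelbartRogawski1991.OscillatorTripleDictionary (rhoTriple)
open Summit.HodgeConjecture.CorCM.Lines.A3Liu413 (datum413)
open Summit.HodgeConjecture.HodgeConjecture.Cruxes.H413.CohFormsCarriers

/-! ## §1 The algebra of the assembly (generic, any `Prop413Data`) — verbatim from the sub-line §4 -/

section Assembly

variable {F₀ E₀ : Type} [Field F₀] [NumberField F₀] [IsTotallyReal F₀] [Field E₀] [NumberField E₀] [Algebra F₀ E₀]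
  [IsTotallyComplex E₀] [Algebra.IsQuadraticExtension F₀ E₀]

/-- **The algebra of the assembly** (generic, any `Prop413Data`): an INJECTIVE `G`-equivariant `ℂ`-linear map `cls : A → H¹_B` on a
`G`-stable target subspace `A` of some `G`-module of functions, composed with a NON-ZERO `G`-equivariant map `θ : ω_t → A`, is a non-zero
intertwiner `ω_t → H¹_B`, i.e. `ω_t` OCCURS (`OccursInH1`). [cite: Liu2021, proof of Prop. 4.13, l. 2145] -/
theorem occursInH1_of_classMap_of_thetaForms (P : Prop413Data F₀ E₀) (τ' : E₀ →+* ℂ) (t : P.Triple)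
    {X : Type} [AddCommGroup X] [Module ℂ X] (R : Representation ℂ P.G X) (A : Submodule ℂ X)
    (cls : ↥A →ₗ[ℂ] P.HB τ') (hinj : Function.Injective cls)
    (hcls : ∀ (g : P.G) (f : ↥A) (hgf : R g (f : X) ∈ A), cls ⟨R g (f : X), hgf⟩ = P.rhoB τ' g (cls f))
    (θ : P.omega t.μ t.isConjugateSymplectic t.ε t.χ →ₗ[ℂ] X) (hθ : θ ≠ 0) (hθA : ∀ v, θ v ∈ A)
    (hθeq : ∀ (g : P.G) (v : P.omega t.μ t.isConjugateSymplectic t.ε t.χ), θ (rhoTriple P t g v) = R g (θ v)) :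
    OccursInH1 P τ' (rhoTriple P t) := by
  -- the composite `v ↦ cls ⟨θ v, _⟩`
  let j : P.omega t.μ t.isConjugateSymplectic t.ε t.χ →ₗ[ℂ] P.HB τ' := cls ∘ₗ LinearMap.codRestrict A θ hθA
  have hj : ∀ (g : P.G) (v : P.omega t.μ t.isConjugateSymplectic t.ε t.χ), j (rhoTriple P t g v) = P.rhoB τ' g (j v) := by
    intro g v
    have hmem : R g (θ v) ∈ A := by rw [← hθeq]; exact hθA _
    have h1 : LinearMap.codRestrict A θ hθA (rhoTriple P t g v) = ⟨R g (θ v), hmem⟩ := by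
      apply Subtype.ext
      simp only [LinearMap.codRestrict_apply, hθeq]
    have h2 := hcls g ⟨θ v, hθA v⟩ hmem
    calc j (rhoTriple P t g v) = cls (LinearMap.codRestrict A θ hθA (rhoTriple P t g v)) := rfl
      _ = cls ⟨R g (θ v), hmem⟩ := by rw [h1]
      _ = P.rhoB τ' g (cls ⟨θ v, hθA v⟩) := h2
      _ = P.rhoB τ' g (j v) := rfl
  refine ⟨LinearMap.intertwiningMap_of_isIntertwiningMap (ρ := rhoTriple P t) (σ := P.rhoB τ') j hj, ?_⟩
  -- non-vanishing: `θ v ≠ 0` for some `v`, and `cls` is injective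
  obtain ⟨v, hv⟩ : ∃ v, θ v ≠ 0 :=
    Classical.by_contradiction fun h => hθ (LinearMap.ext fun w => not_ne_iff.mp (not_exists.mp h w))
  intro hzero
  have hjv : j v = 0 := by
    have := congrArg (fun φ : Representation.IntertwiningMap (rhoTriple P t) (P.rhoB τ') => φ v) hzero
    simpa using this
  have : LinearMap.codRestrict A θ hθA v = 0 := hinj (by simpa [j] using hjv)
  exact hv (by simpa using congrArg Subtype.val this)

end Assembly

/-! ## §2 `T3a → T3b → T3` (the sub-line's `stubT3_of`, letters inlined verbatim) -/

set_option synthInstance.maxHeartbeats 400000 in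
set_option maxHeartbeats 8000000 in
/-- **`T3a → T3b → T3`**: a triple of the holomorphic `ι₁`-class is realised in `holCotForms 𝔞₀ ≤ cohForms 𝔞₀` directly; a triple of the other class
through its conjugate partner `t'` by `θ_t := conjFun ∘ θ_{t'} ∘ J` (values in `conjFun (holCotForms 𝔞₀) ≤ cohForms 𝔞₀`, non-zero, equivariant).
Hypotheses = the bodies of `StubT3aHolThetaRealisationAt` and `StubT3bConjugatePartnerAt`, conclusion = the body of `StubT3ThetaFormsAt`, all VERBATIM.
[cite: Liu2021, proof of Prop. 4.13, l. 2145; App. D Lem. D.2 (2)] [cite: BorelWallach2000, VII 2.10] -/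
theorem thetaFormsAt_of_hol_of_partner
    (h3a :
  (∀ (hDel : Literature.AlgebraicGeometry.ShimuraVarieties.UnitaryCanonicalModel.canonicalModel_exists_printed)
      (F : HodgeCM.CMField) [IsGalois ℚ F] (h6 : 6 ≤ Module.finrank ℚ F) {ι₁ : F →+* ℂ} (V : HodgeCM.HermSpace3 F ι₁) (a₀ : RealScalar F)
      (Φ : CMType F) (hΦ : ι₁ ∈ Φ.1) (i : (I V (repAt a₀) (muLiu ι₁ GramClass.rep))),
      (datum413 hDel F V a₀ Φ i).n = 3 →
        (∀ (t : (datum413 hDel F V a₀ Φ i).Triple), t.HasWeightOne → t.IsAdmissible → ι₁ ∈ t.cmType.1 →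
            ∃ θ : (datum413 hDel F V a₀ Φ i).omega t.μ t.isConjugateSymplectic t.ε t.χ →ₗ[ℂ] ((adelicDatum F V).Adelic → (Fin 2 → ℂ)),
              θ ≠ 0 ∧ (∀ v, θ v ∈ holCotForms (archFactorOf F V)) ∧
                ∀ (g : ↥(HodgeCM.HermSpace3.adelicFin V)) (v : (datum413 hDel F V a₀ Φ i).omega t.μ t.isConjugateSymplectic t.ε t.χ),
                  θ (rhoTriple (datum413 hDel F V a₀ Φ i) t g v) = rightRep F V g (θ v)) ∨
        (∀ (t : (datum413 hDel F V a₀ Φ i).Triple), t.HasWeightOne → t.IsAdmissible → ι₁ ∉ t.cmType.1 →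
            ∃ θ : (datum413 hDel F V a₀ Φ i).omega t.μ t.isConjugateSymplectic t.ε t.χ →ₗ[ℂ] ((adelicDatum F V).Adelic → (Fin 2 → ℂ)),
              θ ≠ 0 ∧ (∀ v, θ v ∈ holCotForms (archFactorOf F V)) ∧
                ∀ (g : ↥(HodgeCM.HermSpace3.adelicFin V)) (v : (datum413 hDel F V a₀ Φ i).omega t.μ t.isConjugateSymplectic t.ε t.χ),
                  θ (rhoTriple (datum413 hDel F V a₀ Φ i) t g v) = rightRep F V g (θ v))))
    (h3b :
  (∀ (hDel : Literature.AlgebraicGeometry.ShimuraVarieties.UnitaryCanonicalModel.canonicalModel_exists_printed)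
      (F : HodgeCM.CMField) [IsGalois ℚ F] (h6 : 6 ≤ Module.finrank ℚ F) {ι₁ : F →+* ℂ} (V : HodgeCM.HermSpace3 F ι₁) (a₀ : RealScalar F)
      (Φ : CMType F) (hΦ : ι₁ ∈ Φ.1) (i : (I V (repAt a₀) (muLiu ι₁ GramClass.rep))),
      (datum413 hDel F V a₀ Φ i).n = 3 →
        ∀ (t : (datum413 hDel F V a₀ Φ i).Triple), t.HasWeightOne → t.IsAdmissible →
          ∃ t' : (datum413 hDel F V a₀ Φ i).Triple, t'.HasWeightOne ∧ t'.IsAdmissible ∧ (ι₁ ∈ t'.cmType.1 ↔ ι₁ ∉ t.cmType.1) ∧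
            ∃ J : (datum413 hDel F V a₀ Φ i).omega t.μ t.isConjugateSymplectic t.ε t.χ →ₛₗ[starRingEnd ℂ]
                (datum413 hDel F V a₀ Φ i).omega t'.μ t'.isConjugateSymplectic t'.ε t'.χ,
              Function.Bijective J ∧
                ∀ (g : ↥(HodgeCM.HermSpace3.adelicFin V)) (v : (datum413 hDel F V a₀ Φ i).omega t.μ t.isConjugateSymplectic t.ε t.χ),
                  J (rhoTriple (datum413 hDel F V a₀ Φ i) t g v) = rhoTriple (datum413 hDel F V a₀ Φ i) t' g (J v))) :
  ∀ (hDel : Literature.AlgebraicGeometry.ShimuraVarieties.UnitaryCanonicalModel.canonicalModel_exists_printed)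
      (F : HodgeCM.CMField) [IsGalois ℚ F] (h6 : 6 ≤ Module.finrank ℚ F) {ι₁ : F →+* ℂ} (V : HodgeCM.HermSpace3 F ι₁) (a₀ : RealScalar F)
      (Φ : CMType F) (hΦ : ι₁ ∈ Φ.1) (i : (I V (repAt a₀) (muLiu ι₁ GramClass.rep))),
      (datum413 hDel F V a₀ Φ i).n = 3 →
        ∀ (t : (datum413 hDel F V a₀ Φ i).Triple), t.HasWeightOne → t.IsAdmissible →
          ∃ θ : (datum413 hDel F V a₀ Φ i).omega t.μ t.isConjugateSymplectic t.ε t.χ →ₗ[ℂ]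
              ((adelicDatum F V).Adelic → (Fin 2 → ℂ)),
            θ ≠ 0 ∧ (∀ v, θ v ∈ cohForms (archFactorOf F V)) ∧
              ∀ (g : ↥(HodgeCM.HermSpace3.adelicFin V)) (v : (datum413 hDel F V a₀ Φ i).omega t.μ t.isConjugateSymplectic t.ε t.χ),
                θ (rhoTriple (datum413 hDel F V a₀ Φ i) t g v) = rightRep F V g (θ v) := by
  intro hDel F _ h6 ι₁ V a₀ Φ hΦ i hn t hw hadm
  -- (i) a holomorphic realisation of `t` itself is a cohomological one
  have direct : (∃ θ : (datum413 hDel F V a₀ Φ i).omega t.μ t.isConjugateSymplectic t.ε t.χ →ₗ[ℂ] ((adelicDatum F V).Adelic → (Fin 2 → ℂ)),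
        θ ≠ 0 ∧ (∀ v, θ v ∈ holCotForms (archFactorOf F V)) ∧
          ∀ (g : ↥(HodgeCM.HermSpace3.adelicFin V)) (v : (datum413 hDel F V a₀ Φ i).omega t.μ t.isConjugateSymplectic t.ε t.χ),
            θ (rhoTriple (datum413 hDel F V a₀ Φ i) t g v) = rightRep F V g (θ v)) →
      ∃ θ : (datum413 hDel F V a₀ Φ i).omega t.μ t.isConjugateSymplectic t.ε t.χ →ₗ[ℂ] ((adelicDatum F V).Adelic → (Fin 2 → ℂ)),
        θ ≠ 0 ∧ (∀ v, θ v ∈ cohForms (archFactorOf F V)) ∧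
          ∀ (g : ↥(HodgeCM.HermSpace3.adelicFin V)) (v : (datum413 hDel F V a₀ Φ i).omega t.μ t.isConjugateSymplectic t.ε t.χ),
            θ (rhoTriple (datum413 hDel F V a₀ Φ i) t g v) = rightRep F V g (θ v) := by
    rintro ⟨θ, hθ, hθA, hθeq⟩
    exact ⟨θ, hθ, fun v => Submodule.mem_sup_left (hθA v), hθeq⟩
  -- (ii) a holomorphic realisation of a conjugate partner `t'` gives an anti-holomorphic one of `t`
  have viaPartner : ∀ t' : (datum413 hDel F V a₀ Φ i).Triple,
      (∃ J : (datum413 hDel F V a₀ Φ i).omega t.μ t.isConjugateSymplectic t.ε t.χ →ₛₗ[starRingEnd ℂ] (datum413 hDel F V a₀ Φ i).omega t'.μ t'.isConjugateSymplectic t'.ε t'.χ,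
          Function.Bijective J ∧
            ∀ (g : ↥(HodgeCM.HermSpace3.adelicFin V)) (v : (datum413 hDel F V a₀ Φ i).omega t.μ t.isConjugateSymplectic t.ε t.χ),
              J (rhoTriple (datum413 hDel F V a₀ Φ i) t g v) = rhoTriple (datum413 hDel F V a₀ Φ i) t' g (J v)) →
      (∃ θ : (datum413 hDel F V a₀ Φ i).omega t'.μ t'.isConjugateSymplectic t'.ε t'.χ →ₗ[ℂ] ((adelicDatum F V).Adelic → (Fin 2 → ℂ)),
        θ ≠ 0 ∧ (∀ v, θ v ∈ holCotForms (archFactorOf F V)) ∧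
          ∀ (g : ↥(HodgeCM.HermSpace3.adelicFin V)) (v : (datum413 hDel F V a₀ Φ i).omega t'.μ t'.isConjugateSymplectic t'.ε t'.χ),
            θ (rhoTriple (datum413 hDel F V a₀ Φ i) t' g v) = rightRep F V g (θ v)) →
      ∃ θ : (datum413 hDel F V a₀ Φ i).omega t.μ t.isConjugateSymplectic t.ε t.χ →ₗ[ℂ] ((adelicDatum F V).Adelic → (Fin 2 → ℂ)),
        θ ≠ 0 ∧ (∀ v, θ v ∈ cohForms (archFactorOf F V)) ∧
          ∀ (g : ↥(HodgeCM.HermSpace3.adelicFin V)) (v : (datum413 hDel F V a₀ Φ i).omega t.μ t.isConjugateSymplectic t.ε t.χ),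
            θ (rhoTriple (datum413 hDel F V a₀ Φ i) t g v) = rightRep F V g (θ v) := by
    rintro t' ⟨J, hJ, hJeq⟩ ⟨θ', hθ', hθ'A, hθ'eq⟩
    -- the conjugate sandwich `v ↦ conj (θ' (J v))` is ℂ-linear (two conjugations)
    let S : (datum413 hDel F V a₀ Φ i).omega t.μ t.isConjugateSymplectic t.ε t.χ →ₗ[ℂ] ((adelicDatum F V).Adelic → (Fin 2 → ℂ)) :=
      { toFun := fun v => conjFun F V (θ' (J v))
        map_add' := fun v w => by simp only [map_add]
        map_smul' := fun c v => by simp only [LinearMap.map_smulₛₗ, RingHom.id_apply, starRingEnd_self_apply] }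
    have hS : ∀ v, S v = conjFun F V (θ' (J v)) := fun _ => rfl
    refine ⟨S, ?_, fun v => ?_, fun g v => ?_⟩
    · -- non-vanishing
      obtain ⟨w, hw⟩ : ∃ w, θ' w ≠ 0 := by
        by_contra hall
        push Not at hall
        exact hθ' (LinearMap.ext hall)
      obtain ⟨v, rfl⟩ := hJ.2 w
      intro hzero
      apply hw
      have h1 : conjFun F V (θ' (J v)) = 0 := by
        have := LinearMap.congr_fun hzero v
        simpa only [hS, LinearMap.zero_apply] using this
      have h2 : conjFun F V (θ' (J v)) = conjFun F V 0 := by rw [h1, map_zero]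
      exact (Function.LeftInverse.injective (conjFun_conjFun F V)) h2
    · -- values in `conjFun (holCotForms 𝔞₀) ≤ cohForms 𝔞₀`
      simp only [hS]
      exact Submodule.mem_sup_right (Submodule.mem_map_of_mem (hθ'A (J v)))
    · -- equivariance
      simp only [hS, hJeq, hθ'eq]
      exact conjFun_rightRep F V g (θ' (J v))
  -- (iii) the two classes
  rcases h3a hDel F h6 V a₀ Φ hΦ i hn with hIn | hOut
  · by_cases hι : ι₁ ∈ t.cmType.1
    · exact direct (hIn t hw hadm hι)
    · obtain ⟨t', hw', hadm', hflip, hJ⟩ := h3b hDel F h6 V a₀ Φ hΦ i hn t hw hadm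
      exact viaPartner t' hJ (hIn t' hw' hadm' (hflip.mpr hι))
  · by_cases hι : ι₁ ∈ t.cmType.1
    · obtain ⟨t', hw', hadm', hflip, hJ⟩ := h3b hDel F h6 V a₀ Φ hΦ i hn t hw hadm
      exact viaPartner t' hJ (hOut t' hw' hadm' (fun h' => hflip.mp h' hι))
    · exact direct (hOut t hw hadm hι)

/-! ## §3 `T2 → T3 → hocc` (the sub-line's HEAD 1, letters inlined verbatim) and `T3 → hocc` over ★ T2 -/

set_option synthInstance.maxHeartbeats 400000 in
set_option maxHeartbeats 8000000 in
/-- **`T2 → T3 → hocc`**: unfold the `hocc` letter to the face, take the class map (T2, `3 ≤ n` from `n = 3`) and the theta map (T3), and apply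
`occursInH1_of_classMap_of_thetaForms`.  Hypotheses = bodies of `StubT2MatsushimaHodgeAt`, `StubT3ThetaFormsAt`; conclusion = body of `HoccType` (= the
registry stub `stub_admissible_occursInH1` of `Lines/a3_liu413.lean`), all VERBATIM. [cite: Liu2021, proof of Prop. 4.13, l. 2145] -/
theorem hocc_of_classMap_of_thetaFormsAt
    (h2 :
  (∀ (hDel : Literature.AlgebraicGeometry.ShimuraVarieties.UnitaryCanonicalModel.canonicalModel_exists_printed)
      (F : HodgeCM.CMField) [IsGalois ℚ F] (h6 : 6 ≤ Module.finrank ℚ F) {ι₁ : F →+* ℂ} (V : HodgeCM.HermSpace3 F ι₁) (a₀ : RealScalar F)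
      (Φ : CMType F) (hΦ : ι₁ ∈ Φ.1) (i : (I V (repAt a₀) (muLiu ι₁ GramClass.rep))),
      3 ≤ (datum413 hDel F V a₀ Φ i).n → ∀ τ' : HodgeCM.CMField.K F →+* ℂ,
        ∃ cls : ↥(cohForms (archFactorOf F V)) →ₗ[ℂ] (datum413 hDel F V a₀ Φ i).HB τ',
          Function.Injective cls ∧
            ∀ (g : ↥(HodgeCM.HermSpace3.adelicFin V)) (f : ↥(cohForms (archFactorOf F V)))
              (hgf : rightRep F V g (f : _) ∈ cohForms (archFactorOf F V)),
              cls ⟨rightRep F V g (f : _), hgf⟩ = (datum413 hDel F V a₀ Φ i).rhoB τ' g (cls f)))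
    (h3 :
  (∀ (hDel : Literature.AlgebraicGeometry.ShimuraVarieties.UnitaryCanonicalModel.canonicalModel_exists_printed)
      (F : HodgeCM.CMField) [IsGalois ℚ F] (h6 : 6 ≤ Module.finrank ℚ F) {ι₁ : F →+* ℂ} (V : HodgeCM.HermSpace3 F ι₁) (a₀ : RealScalar F)
      (Φ : CMType F) (hΦ : ι₁ ∈ Φ.1) (i : (I V (repAt a₀) (muLiu ι₁ GramClass.rep))),
      (datum413 hDel F V a₀ Φ i).n = 3 →
        ∀ (t : (datum413 hDel F V a₀ Φ i).Triple), t.HasWeightOne → t.IsAdmissible →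
          ∃ θ : (datum413 hDel F V a₀ Φ i).omega t.μ t.isConjugateSymplectic t.ε t.χ →ₗ[ℂ]
              ((adelicDatum F V).Adelic → (Fin 2 → ℂ)),
            θ ≠ 0 ∧ (∀ v, θ v ∈ cohForms (archFactorOf F V)) ∧
              ∀ (g : ↥(HodgeCM.HermSpace3.adelicFin V)) (v : (datum413 hDel F V a₀ Φ i).omega t.μ t.isConjugateSymplectic t.ε t.χ),
                θ (rhoTriple (datum413 hDel F V a₀ Φ i) t g v) = rightRep F V g (θ v))) :
  ∀ (hDel : Literature.AlgebraicGeometry.ShimuraVarieties.UnitaryCanonicalModel.canonicalModel_exists_printed)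
    (F : HodgeCM.CMField) [IsGalois ℚ F] (h6 : 6 ≤ Module.finrank ℚ F) {ι₁ : F →+* ℂ} (V : HodgeCM.HermSpace3 F ι₁) (a₀ : RealScalar F)
    (Φ : CMType F) (hΦ : ι₁ ∈ Φ.1) (i : (I V (repAt a₀) (muLiu ι₁ GramClass.rep))),
    admissible_occursInH1 (((uniformOmegaRep (Summit.HodgeConjecture.CorCM.DelRec.exists_recordSystem_of_printed hDel) ⟨HodgeCM.CMField.K F⟩ ι₁ ⟨HodgeCM.HermSpace3.Hm V, HodgeCM.HermSpace3.isHermitian V, HodgeCM.HermSpace3.signature_ι₁ V, HodgeCM.HermSpace3.posDef_of_ne V⟩ Φ e₁ (frameD V) (frameD_real V) (frameD_ne V) (ιVE V) (2 * imagUnit (HodgeCM.CMField.K F))⁻¹ (fun _ _ => (Rep.update ↥(maximalRealSubfield (HodgeCM.CMField.K F)) (imagUnitSq (HodgeCM.CMField.K F)) (Rep.ofLineOf ↥(maximalRealSubfield (HodgeCM.CMField.K F)) (imagUnitSq (HodgeCM.CMField.K F))) (locF ↥(maximalRealSubfield (HodgeCM.CMField.K F)) (imagUnitSq (HodgeCM.CMField.K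 F)) (realUnit ⟨HodgeCM.CMField.K F⟩ (repAt a₀ (Sigma.fst i)).1 (repAt a₀ (Sigma.fst i)).2.1 (repAt a₀ (Sigma.fst i)).2.2)) (realUnit ⟨HodgeCM.CMField.K F⟩ (repAt a₀ (Sigma.fst i)).1 (repAt a₀ (Sigma.fst i)).2.1 (repAt a₀ (Sigma.fst i)).2.2) rfl)))).prop413Data ((liuDictionaryPin exists_isReal_hodgeModel_holds hodgePQ_independent_of_hodgeModel_holds BallQuotient.ballQuotientUniformised_holds (cmAbelianVarietyRealised_of_eigenbasis exists_isReal_hodgeModel_holds hodgePQ_independent_of_hodgeModel_holds cmAbelianVarietyEigenbasisRealised_holds) Literature.NumberTheory.Transcendental.arapura2012_cor_15_4_6_holds V (I V (repAt a₀) (muLiu ι₁ GramClass.rep)) (line V (repAt a₀) (muLiu ι₁ GramClass.rep)))).H) := by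
  intro hDel F _ h6 ι₁ V a₀ Φ hΦ i hn τ' t hw hadm
  obtain ⟨cls, hinj, hcls⟩ := h2 hDel F h6 V a₀ Φ hΦ i (le_of_eq hn.symm) τ'
  obtain ⟨θ, hθ, hθA, hθeq⟩ := h3 hDel F h6 V a₀ Φ hΦ i hn t hw hadm
  exact occursInH1_of_classMap_of_thetaForms (datum413 hDel F V a₀ Φ i) τ' t (rightRep F V) (cohForms (archFactorOf F V)) cls hinj hcls
    θ hθ hθA hθeq

set_option synthInstance.maxHeartbeats 400000 in
set_option maxHeartbeats 8000000 in
/-- **`T3 → hocc`** over the ★ T2 node `MatsushimaHodge.t2_matsushimaHodgeAt` (p792532): once `StubT3ThetaFormsAt` is a ★ theorem, the registry hole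
`stub_admissible_occursInH1` folds by `hocc_of_thetaFormsAt <it>`. [cite: Liu2021, proof of Prop. 4.13, l. 2145] -/
theorem hocc_of_thetaFormsAt
    (h3 :
  (∀ (hDel : Literature.AlgebraicGeometry.ShimuraVarieties.UnitaryCanonicalModel.canonicalModel_exists_printed)
      (F : HodgeCM.CMField) [IsGalois ℚ F] (h6 : 6 ≤ Module.finrank ℚ F) {ι₁ : F →+* ℂ} (V : HodgeCM.HermSpace3 F ι₁) (a₀ : RealScalar F)
      (Φ : CMType F) (hΦ : ι₁ ∈ Φ.1) (i : (I V (repAt a₀) (muLiu ι₁ GramClass.rep))),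
      (datum413 hDel F V a₀ Φ i).n = 3 →
        ∀ (t : (datum413 hDel F V a₀ Φ i).Triple), t.HasWeightOne → t.IsAdmissible →
          ∃ θ : (datum413 hDel F V a₀ Φ i).omega t.μ t.isConjugateSymplectic t.ε t.χ →ₗ[ℂ]
              ((adelicDatum F V).Adelic → (Fin 2 → ℂ)),
            θ ≠ 0 ∧ (∀ v, θ v ∈ cohForms (archFactorOf F V)) ∧
              ∀ (g : ↥(HodgeCM.HermSpace3.adelicFin V)) (v : (datum413 hDel F V a₀ Φ i).omega t.μ t.isConjugateSymplectic t.ε t.χ),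
                θ (rhoTriple (datum413 hDel F V a₀ Φ i) t g v) = rightRep F V g (θ v))) :
  ∀ (hDel : Literature.AlgebraicGeometry.ShimuraVarieties.UnitaryCanonicalModel.canonicalModel_exists_printed)
    (F : HodgeCM.CMField) [IsGalois ℚ F] (h6 : 6 ≤ Module.finrank ℚ F) {ι₁ : F →+* ℂ} (V : HodgeCM.HermSpace3 F ι₁) (a₀ : RealScalar F)
    (Φ : CMType F) (hΦ : ι₁ ∈ Φ.1) (i : (I V (repAt a₀) (muLiu ι₁ GramClass.rep))),
    admissible_occursInH1 (((uniformOmegaRep (Summit.HodgeConjecture.CorCM.DelRec.exists_recordSystem_of_printed hDel) ⟨HodgeCM.CMField.K F⟩ ι₁ ⟨HodgeCM.HermSpace3.Hm V, HodgeCM.HermSpace3.isHermitian V, HodgeCM.HermSpace3.signature_ι₁ V, HodgeCM.HermSpace3.posDef_of_ne V⟩ Φ e₁ (frameD V) (frameD_real V) (frameD_ne V) (ιVE V) (2 * imagUnit (HodgeCM.CMField.K F))⁻¹ (fun _ _ => (Rep.update ↥(maximalRealSubfield (HodgeCM.CMField.K F)) (imagUnitSq (HodgeCM.CMField.K F)) (Rep.ofLineOf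 ↥(maximalRealSubfield (HodgeCM.CMField.K F)) (imagUnitSq (HodgeCM.CMField.K F))) (locF ↥(maximalRealSubfield (HodgeCM.CMField.K F)) (imagUnitSq (HodgeCM.CMField.K F)) (realUnit ⟨HodgeCM.CMField.K F⟩ (repAt a₀ (Sigma.fst i)).1 (repAt a₀ (Sigma.fst i)).2.1 (repAt a₀ (Sigma.fst i)).2.2)) (realUnit ⟨HodgeCM.CMField.K F⟩ (repAt a₀ (Sigma.fst i)).1 (repAt a₀ (Sigma.fst i)).2.1 (repAt a₀ (Sigma.fst i)).2.2) rfl)))).prop413Data ((liuDictionaryPin exists_isReal_hodgeModel_holds hodgePQ_independent_of_hodgeModel_holds BallQuotient.ballQuotientUniformised_holds (cmAbelianVarietyRealised_of_eigenbasis exists_isReal_hodgeModel_holds hodgePQ_independent_of_hodgeModel_holds cmAbelianVarietyEigenbasisRealised_holds) Literature.NumberTheory.Transcendental.arapura2012_cor_15_4_6_holds V (I V (repAt a₀) (muLiu ι₁ GramClass.rep)) (line V (repAt a₀) (muLiu ι₁ GramClass.rep)))).H) :=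
  hocc_of_classMap_of_thetaFormsAt Summit.HodgeConjecture.HodgeConjecture.Cruxes.H413.MatsushimaHodge.t2_matsushimaHodgeAt h3

end Summit.HodgeConjecture.HodgeConjecture.Cruxes.H413.HoccGlue

end
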